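import Literature.Computability.AlgebraicComplexity.YoungSubgroupBranching
import Literature.Computability.AlgebraicComplexity.MultiLRCoeffVanishing
import Literature.Computability.AlgebraicComplexity.IK2020PowerSumInvariantsDecompositionProofs
import HarnessLib

/-!
# Ikenmeyer–Kandasamy 2020, Prop. 10.1: the assembly `dim ({λ}_ϱ)^{𝔖_m} = b(λ, ϱ, D, d)`

Topic `Literature/Computability/AlgebraicComplexity` (val-lit cell, board U1). Theorems only.

IK 2020 Prop. 10.1 (arXiv:1911.03990, TeX L850–880; tree fact `IK2020_prop_10_1`,
`IK20HighestWeightVectors.lean`): for `λ ⊢_m dD` and `ϱ ⊢_m d`,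
`dim ({λ}_ϱ)^{𝔖_m} = b(λ,ϱ,D,d) = ∑_{μ•} c^λ_{μ¹…μ^d} ∏_i a_{μ^i}(ρ̂_i, iD)`. The tree's proof is
distributed over: t01's `IK2020_prop_10_1_of_finrank_invariants_eq_bCoeff`
(`IK2020ContentSliceTransport.lean`: Claim 10.2, the word model and t08's slice characters reduce
the statement to `dim (HW_λ)^{K_γ(w₀)} = b(λ,ϱ,D,d)` for ONE word `w₀` of content `D·ϱ`),
`YoungSubgroupBranching.exists_word_subgroup_finrank_eq_bCoeff` (the character-theoretic core:
branching from `𝔖_n` to a product of subgroups of the Young subgroup `∏_i 𝔖_{D(i+1)ρ̂_{i+1}}`),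
`IK2020.multiLRCoeff_eq_zero_of_lt_card_parts` (`c^λ_{μ•} = 0` when some `ℓ(μ^i) > m`), and the
word side (a block word `w₀` with `K_γ(w₀) = ψ(∏_i 𝔖_{ρ̂_{i+1}} ≀ 𝔖_{(i+1)D})` and the wreath
averages `a_{μ^i}(ρ̂_{i+1}, (i+1)D)`).

This file:
* `IK2020.sum_succ_mul_count_eq_sum`, `IK2020.sum_blockSize_eq`: the block sizes
  `n_i = D(i+1)ρ̂_{i+1}` add up to `dD` (`∑_i i ρ̂_i = |ϱ| = d`);
* `IK2020_prop_10_1_of_blockWord`: Prop. 10.1 from ANY family of block subgroups `K_i` with the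
  two word-side properties (wreath averages = plethysm coefficients; a block word of content
  `D·ϱ` whose stabiliser up to relabelling is `ψ(∏ K_i)`).

Honest framing: bookkeeping of a printed proof about IK's toy model; VP ≠ VNP is NOT proved and
nothing here is progress on it.

## References

* [IkenmeyerKandasamy2019] C. Ikenmeyer, U. Kandasamy, arXiv:1911.03990, Prop. 10.1 and its
  proof (§10).
-/

noncomputable section

open scoped BigOperators

namespace Literature.Computability.AlgebraicComplexity

open _root_.Literature.NumberTheory.DiophantineGeometry

namespace IK2020

/-- `∑_{j < d} (j+1) · #{a ∈ s | a = j+1} = ∑ s` for a multiset of naturals in `[1, d]`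
(frequency notation: `∑_i i ρ̂_i = |ϱ|`, IK §3). [cite: IkenmeyerKandasamy2019, §3] -/
theorem sum_succ_mul_count_eq_sum (d : ℕ) :
    ∀ s : Multiset ℕ, (∀ a ∈ s, 0 < a ∧ a ≤ d) →
      ∑ j : Fin d, (j.1 + 1) * s.count (j.1 + 1) = s.sum := by
  classical
  intro s
  induction s using Multiset.induction_on with
  | empty => intro _; simp
  | cons a t ih =>
    intro h
    have ha := h a (Multiset.mem_cons_self a t)
    have ht : ∀ b ∈ t, 0 < b ∧ b ≤ d := fun b hb => h b (Multiset.mem_cons_of_mem hb)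
    rw [Multiset.sum_cons, ← ih ht]
    simp_rw [Multiset.count_cons, mul_add, Finset.sum_add_distrib]
    rw [add_comm]
    congr 1
    rw [Finset.sum_eq_single (⟨a - 1, by omega⟩ : Fin d)]
    · simp only
      rw [if_pos (by omega), mul_one]
      omega
    · intro j _ hj
      rw [if_neg, mul_zero]
      intro hja
      apply hj
      ext
      simp only
      omega
    · intro h0
      exact absurd (Finset.mem_univ _) h0

/-- **The block sizes add up to the number of positions**: `∑_{i<d} D·(i+1)·ρ̂_{i+1} = d·D` for
`ϱ ⊢ d` (`ρ̂_i = #{j | ϱ_j = i}`, IK §3; `∑_i i ρ̂_i = d`). [cite: IkenmeyerKandasamy2019, §3] -/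
theorem sum_blockSize_eq (D d : ℕ) (ρ : Nat.Partition d) :
    (∑ j : Fin d, D * (j.1 + 1) * freq ρ (j.1 + 1)) = d * D := by
  have h := sum_succ_mul_count_eq_sum d ρ.parts fun a ha =>
    ⟨ρ.parts_pos ha, by
      have := Multiset.le_sum_of_mem ha
      rw [ρ.parts_sum] at this
      exact this⟩
  rw [ρ.parts_sum] at h
  simp_rw [freq, mul_assoc]
  rw [← Finset.mul_sum, h, mul_comm]

end IK2020

open IK2020

/-- **Prop. 10.1 from the word side.** Let, for all `m, D, d` and `ϱ ⊢ d`, block subgroups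
`K_i ≤ 𝔖_{D(i+1)ρ̂_{i+1}}` (`i < d`) be given such that (W2) for `0 < D` the `K_i`-average of every
Specht character `χ^μ`, `μ ⊢ D(i+1)ρ̂_{i+1}` with at most `m` parts, is the plethysm coefficient
`a_μ(ρ̂_{i+1}, (i+1)D)` for `GL_m`, and (W1) for `0 < D` and `ℓ(ϱ) ≤ m` there is a word `w₀` on
the positions `Fin (∑_i D(i+1)ρ̂_{i+1})` with content `D·ϱ` whose stabiliser up to relabelling of
the letters `{τ | ∃ σ, σ ∘ w₀ ∘ τ = w₀}` is the image `ψ(∏_i K_i)` under the Young embedding. Then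
IK 2020 Prop. 10.1 holds (for IK's `K_i = 𝔖_{ρ̂_{i+1}} ≀ 𝔖_{(i+1)D}` both are the content of §10;
the assembly is t01's `IK2020_prop_10_1_of_finrank_invariants_eq_bCoeff`, the branching core
`YoungSubgroupBranching.exists_word_subgroup_finrank_eq_bCoeff`, the vanishing
`IK2020.multiLRCoeff_eq_zero_of_lt_card_parts` and `∑ n_i = dD`).
[cite: IkenmeyerKandasamy2019, Prop. 10.1] -/
theorem IK2020_prop_10_1_of_blockWord
    (K : ∀ (m D d : ℕ) (ρ : Nat.Partition d) (i : Fin d),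
      Subgroup (Equiv.Perm (Fin (D * (i.1 + 1) * freq ρ (i.1 + 1)))))
    (hW2 : ∀ (m D d : ℕ) (ρ : Nat.Partition d), 0 < D → ∀ (i : Fin d)
      (μ : Nat.Partition (D * (i.1 + 1) * freq ρ (i.1 + 1))), μ.parts.card ≤ m →
        ∀ [Fintype ↥(K m D d ρ i)],
          (Nat.card ↥(K m D d ρ i) : ℂ)⁻¹ * ∑ s : ↥(K m D d ρ i), spechtCharacter ℂ μ
              (s : Equiv.Perm (Fin (D * (i.1 + 1) * freq ρ (i.1 + 1)))) =
            (plethysmCoeffOfPartition ℂ m ((i.1 + 1) * D) μ : ℂ))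
    (hW1 : ∀ (m D d : ℕ) (ρ : Nat.Partition d), 0 < D → ρ.parts.card ≤ m →
      ∃ w₀ : Word m (∑ j : Fin d, D * (j.1 + 1) * freq ρ (j.1 + 1)),
        (wordContent w₀ = fun i : Fin m => D * ρ.sortedParts.getD (i : ℕ) 0) ∧
        ∀ τ : Equiv.Perm (Fin (∑ j : Fin d, D * (j.1 + 1) * freq ρ (j.1 + 1))),
          (∃ σ : Equiv.Perm (Fin m), ⇑σ ∘ w₀ ∘ ⇑τ = w₀) ↔
            ∃ y : (i : Fin d) → Equiv.Perm (Fin (D * (i.1 + 1) * freq ρ (i.1 + 1))),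
              (∀ i, y i ∈ K m D d ρ i) ∧
                ((Equiv.permCongrHom (finSigmaFinEquiv
                    (n := fun j : Fin d => D * (j.1 + 1) * freq ρ (j.1 + 1)))).toMonoidHom.comp
                  (Equiv.Perm.sigmaCongrRightHom fun j : Fin d =>
                    Fin (D * (j.1 + 1) * freq ρ (j.1 + 1)))) y = τ) :
    IK2020_prop_10_1 := by
  refine IK2020_prop_10_1_of_finrank_invariants_eq_bCoeff fun m D d hD hDm lam hlam ρ hρ => ?_
  have hD0 : 0 < D := by omega
  obtain ⟨w₀, hw₀, hKw₀⟩ := hW1 m D d ρ hD0 hρ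
  exact YoungBranching.exists_word_subgroup_finrank_eq_bCoeff m D d ρ (K m D d ρ)
    (fun i μ hμ => hW2 m D d ρ hD0 i μ hμ)
    (fun μ s lam' i hi => IK2020.multiLRCoeff_eq_zero_of_lt_card_parts (k := ℂ) μ hi lam')
    w₀ hw₀ hKw₀ (d * D) (sum_blockSize_eq D d ρ) lam hlam

/-- Prop. 4.1 follows from Prop. 10.1 by the tree's reduction `IK2020_prop_4_1_of_prop_10_1`
(IK §10: "Prop. 4.1 … follows from Prop. 10.1 and Thm. 9.1"); hence Prop. 4.1 from the word side
too. [cite: IkenmeyerKandasamy2019, Prop. 4.1] -/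
theorem IK2020_prop_4_1_of_blockWord
    (K : ∀ (m D d : ℕ) (ρ : Nat.Partition d) (i : Fin d),
      Subgroup (Equiv.Perm (Fin (D * (i.1 + 1) * freq ρ (i.1 + 1)))))
    (hW2 : ∀ (m D d : ℕ) (ρ : Nat.Partition d), 0 < D → ∀ (i : Fin d)
      (μ : Nat.Partition (D * (i.1 + 1) * freq ρ (i.1 + 1))), μ.parts.card ≤ m →
        ∀ [Fintype ↥(K m D d ρ i)],
          (Nat.card ↥(K m D d ρ i) : ℂ)⁻¹ * ∑ s : ↥(K m D d ρ i), spechtCharacter ℂ μ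
              (s : Equiv.Perm (Fin (D * (i.1 + 1) * freq ρ (i.1 + 1)))) =
            (plethysmCoeffOfPartition ℂ m ((i.1 + 1) * D) μ : ℂ))
    (hW1 : ∀ (m D d : ℕ) (ρ : Nat.Partition d), 0 < D → ρ.parts.card ≤ m →
      ∃ w₀ : Word m (∑ j : Fin d, D * (j.1 + 1) * freq ρ (j.1 + 1)),
        (wordContent w₀ = fun i : Fin m => D * ρ.sortedParts.getD (i : ℕ) 0) ∧
        ∀ τ : Equiv.Perm (Fin (∑ j : Fin d, D * (j.1 + 1) * freq ρ (j.1 + 1))),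
          (∃ σ : Equiv.Perm (Fin m), ⇑σ ∘ w₀ ∘ ⇑τ = w₀) ↔
            ∃ y : (i : Fin d) → Equiv.Perm (Fin (D * (i.1 + 1) * freq ρ (i.1 + 1))),
              (∀ i, y i ∈ K m D d ρ i) ∧
                ((Equiv.permCongrHom (finSigmaFinEquiv
                    (n := fun j : Fin d => D * (j.1 + 1) * freq ρ (j.1 + 1)))).toMonoidHom.comp
                  (Equiv.Perm.sigmaCongrRightHom fun j : Fin d =>
                    Fin (D * (j.1 + 1) * freq ρ (j.1 + 1)))) y = τ) :
    IK2020_prop_4_1 :=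
  IK2020_prop_4_1_of_prop_10_1 (IK2020_prop_10_1_of_blockWord K hW2 hW1)

end Literature.Computability.AlgebraicComplexity

end
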